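import Summits.QuantumFields.YangMills.Theorems.FlatTubeReductionOuterCoerciveCurrency
import Summits.QuantumFields.YangMills.Theorems.LuscherReductionOneSiteLevelsKacJump
import HarnessLib

/-!
# (OC) seam: the eigen-scale outer coercivity ⟸ its restriction to crux ONE's toron balls (`vacDist < 2√λ_b` on every link) — the FAR region is crux ONE's landed OUTER
# (route `FlatTubeReduction`, crux K1 `NearFlatRatioLaw` stmt-QuantumFields-24720, skeleton «ratepack-v2» stub `stub_outerCoercive`; seat `ym-line-ftr-p1` g10;
# R2b1 RECORD rung — no summit statement is proved here)

`stub_outerCoercive` ⟸ (`outerCoercive_of_absRate`, p665730) the absolute rate `linkC³e^{−Eλ_b + Cλ_b²}` for every `E` on physical functions vanishing on the eigen-scale toron windows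
`⋃_z {orbitDist(τ_z ·) < Rλ_b}`.  THIS FILE removes the FAR region: split with crux ONE's phase `Θ_B = onePhase (√λ_b)` (`qform_le_localized_cos_sin`, defect `O(λ_b²)·linkCE`,
`defect_scale`); the `sin Θ_B`-piece is crux ONE's landed OUTER at any level `N` with `physLevel (N+1) ≥ E` (`oneSiteAbsUpperValleyMag`, `absUpperOuter_of_valleyMag`,
`LuscherSimonGap_holds`); the additive defect is absorbed into the exponent (`1 + x ≤ eˣ`).  What remains (`absRate_of_annulus`) is the ANNULUS estimate: the same absolute rate for
physical functions supported in `{∀z, Rλ_b ≤ orbitDist(τ_z ·)} ∩ {∀e, vacDist(U_e) < 2√λ_b}` — the matrix-model regime of crux ONE's Kac comparison.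
HONEST FRAMING: seam only; the annulus estimate is OPEN; femto rung R2b1 (RECORD label); not infinite volume, not a gap, not Clay.  No defs, no named facts, no `sorry`.
-/

set_option autoImplicit false

noncomputable section

open MeasureTheory Filter Topology Real
open scoped BigOperators
open Literature.MathematicalPhysics.QuantumFieldTheory
open Literature.MathematicalPhysics.QuantumLattice
open Literature.Analysis.OperatorTheory.YMMatrixModel

namespace Summit.QuantumFields.YangMills.Theorems.FemtoTransferGap.RateTube

open Summit.QuantumFields.YangMills.Theorems.FemtoTransferGap

/-- Absorbing an additive `O(λ²)` defect into the exponent: for `0 ≤ λ ≤ 1`, `0 ≤ D`: `e^{−Eλ + C'λ²} + Dλ² ≤ e^{−Eλ + (C' + D·e^{|E|+|C'|})λ²}`. [folklore] -/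
theorem exp_add_defect_le {E C' D lam : ℝ} (hD : 0 ≤ D) (hlam0 : 0 ≤ lam) (hlam1 : lam ≤ 1) :
    Real.exp (-(E * lam) + C' * lam ^ 2) + D * lam ^ 2 ≤ Real.exp (-(E * lam) + (C' + D * Real.exp (|E| + |C'|)) * lam ^ 2) := by
  set a : ℝ := -(E * lam) + C' * lam ^ 2 with ha
  have hback : -a ≤ |E| + |C'| := by
    rw [ha]
    have h1 : E * lam ≤ |E| := by
      have := mul_le_mul_of_nonneg_right (le_abs_self E) hlam0; nlinarith [abs_nonneg E]
    have h2 : -(C' * lam ^ 2) ≤ |C'| := by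
      have h3 : lam ^ 2 ≤ 1 := by nlinarith
      have := mul_le_mul_of_nonneg_right (neg_abs_le C') (sq_nonneg lam)
      nlinarith [abs_nonneg C']
    linarith
  -- `Dλ² = e^{a}·(Dλ²e^{−a}) ≤ e^{a}·Dλ²e^{|E|+|C'|}`
  have hx : D * lam ^ 2 ≤ Real.exp a * (D * Real.exp (|E| + |C'|) * lam ^ 2) := by
    have e1 : D * lam ^ 2 = Real.exp a * (D * Real.exp (-a) * lam ^ 2) := by
      have : Real.exp a * Real.exp (-a) = 1 := by rw [← Real.exp_add, add_neg_cancel, Real.exp_zero]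
      calc D * lam ^ 2 = (Real.exp a * Real.exp (-a)) * (D * lam ^ 2) := by rw [this, one_mul]
        _ = _ := by ring
    rw [e1]
    refine mul_le_mul_of_nonneg_left ?_ (Real.exp_pos a).le
    exact mul_le_mul_of_nonneg_right (mul_le_mul_of_nonneg_left (Real.exp_le_exp.mpr hback) hD) (sq_nonneg lam)
  have hexp : 1 + D * Real.exp (|E| + |C'|) * lam ^ 2 ≤ Real.exp (D * Real.exp (|E| + |C'|) * lam ^ 2) := by
    have := Real.add_one_le_exp (D * Real.exp (|E| + |C'|) * lam ^ 2); linarith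
  calc Real.exp a + D * lam ^ 2 ≤ Real.exp a * (1 + D * Real.exp (|E| + |C'|) * lam ^ 2) := by rw [mul_add, mul_one]; linarith
    _ ≤ Real.exp a * Real.exp (D * Real.exp (|E| + |C'|) * lam ^ 2) := mul_le_mul_of_nonneg_left hexp (Real.exp_pos a).le
    _ = Real.exp (-(E * lam) + (C' + D * Real.exp (|E| + |C'|)) * lam ^ 2) := by rw [← Real.exp_add, ha]; ring_nf

set_option maxHeartbeats 400000 in
/-- ★★ **(OC-abs) from the ANNULUS.**  If for every `E` the physical functions supported in `{∀z, Rλ_b ≤ orbitDist(τ_z ·)} ∩ {∀e, vacDist(U_e) < 2√λ_b(B)}` obey the absolute rate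
`linkC B³·e^{−Eλ_b + Cλ_b²}` (for `B ≥ B₁`, some `R(E) > 0`, `C(E)`), then so do all physical functions vanishing on the eigen-scale toron windows — the FAR region is crux ONE's
OUTER at a level `N` with `physLevel (N+1) ≥ E`. [cite: SimonB1983DiscreteSpectrum, §3] [cite: Luscher1983, §2] -/
theorem absRate_of_annulus
    (hann : ∀ E : ℝ, ∃ R B₁ C : ℝ, 0 < R ∧ ∀ B : ℝ, B₁ ≤ B → ∀ ψ : GaugeConfig 3 1 SU2 → ℝ, IsPhys ψ →
      (∀ U, ψ U ≠ 0 → (∀ z : Fin 3 → Bool, R * bareLambda B ≤ orbitDist (TT.twist3 z U)) ∧ ∀ e : Edge 3 1, vacDist (U e) < 2 * onePhaseScale B) →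
        qform su2Rep B ψ ψ ≤ linkC B ^ 3 * Real.exp (-(E * bareLambda B) + C * bareLambda B ^ 2) * l2 ψ ψ) :
    ∀ E : ℝ, ∃ R B₁ C : ℝ, 0 < R ∧ ∀ B : ℝ, B₁ ≤ B → ∀ ψ : GaugeConfig 3 1 SU2 → ℝ, IsPhys ψ →
      (∀ U, ψ U ≠ 0 → ∀ z : Fin 3 → Bool, R * bareLambda B ≤ orbitDist (TT.twist3 z U)) →
        qform su2Rep B ψ ψ ≤ linkC B ^ 3 * Real.exp (-(E * bareLambda B) + C * bareLambda B ^ 2) * l2 ψ ψ := by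
  intro E
  -- a level `N` with `physLevel (N+1) ≥ E`, and crux ONE's OUTER at that level
  obtain ⟨htend, -⟩ := LuscherSimonGap_holds
  obtain ⟨N, hN⟩ := (Filter.tendsto_atTop_atTop.mp htend) E
  have hEN : E ≤ physLevel (N + 1) := hN (N + 1) (Nat.le_succ N)
  obtain ⟨Cv, Bv, hBv, hval⟩ := oneSiteAbsUpperValleyMag N
  obtain ⟨C₂, B₂, hB₂, hout⟩ := absUpperOuter_of_valleyMag N hBv hval
  obtain ⟨R, B₁, C₁, hR, hin⟩ := hann E
  set D : ℝ := (9 / 4) * (Real.pi ^ 2 / 4) * cM2 with hDdef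
  have hD0 : 0 ≤ D := by rw [hDdef]; have := cM2_pos; positivity
  set C' : ℝ := max C₁ C₂ with hC'
  refine ⟨R, max (max B₁ B₂) 2, C' + D * Real.exp (|E| + |C'|), hR, fun B hB ψ hψ hsupp => ?_⟩
  have hB1' : B₁ ≤ B := ((le_max_left _ _).trans (le_max_left _ _)).trans hB
  have hB2' : B₂ ≤ B := ((le_max_right _ _).trans (le_max_left _ _)).trans hB
  have hB2 : 2 ≤ B := (le_max_right _ _).trans hB
  have hB0 : 0 < B := by linarith
  set lam := bareLambda B with hlam
  have hlam0 : 0 < lam := bareLambda_pos' hB0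
  have hlam1 : lam ≤ 1 := by
    have h2B : 2 / (1 : ℝ) ^ 3 ≤ B := by rw [one_pow, div_one]; exact hB2
    have h := bareLambda_cube_le (L := 1) (zero_lt_one : (0 : ℝ) < 1) h2B
    have e1B : ((1 : ℕ) : ℝ) ^ 3 * B = B := by simp
    rw [e1B] at h; exact h
  have hCE : linkCE B = linkC B ^ 3 := by rw [linkCE, card_edge_one]
  have hlink : 0 ≤ linkC B ^ 3 := pow_nonneg (linkC_pos hB0.le).le 3
  -- the IMS split along crux ONE's phase
  set ℓ := onePhaseScale B with hℓ
  have hℓ0 : 0 < ℓ := onePhaseScale_pos hB0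
  have hΛ0 : 0 ≤ Real.pi / 2 / ℓ := by positivity
  have hims := qform_le_localized_cos_sin hB0 (measurable_onePhase ℓ) hΛ0 (abs_onePhase_sub_le hℓ0) (onePhase_gaugeTransform ℓ)
    (fun k z hz U => onePhase_twist ℓ k hz U) hψ
  have hdef := defect_scale hB0 (onePhaseScale_lipschitzSq hB0)
  have hcP : IsPhys fun U => Real.cos (onePhase ℓ U) * ψ U := isPhys_cos_onePhase_mul ℓ hψ
  set nc : ℝ := l2 (fun U => Real.cos (onePhase ℓ U) * ψ U) (fun U => Real.cos (onePhase ℓ U) * ψ U) with hnc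
  set ns : ℝ := l2 (fun U => Real.sin (onePhase ℓ U) * ψ U) (fun U => Real.sin (onePhase ℓ U) * ψ U) with hns
  set Nn : ℝ := l2 ψ ψ with hNn
  have hnc0 : 0 ≤ nc := l2_self_nonneg_lat _
  have hns0 : 0 ≤ ns := l2_self_nonneg_lat _
  have hN0 : 0 ≤ Nn := l2_self_nonneg_lat _
  have hsum : nc + ns = Nn := l2_cos_add_l2_sin (measurable_onePhase ℓ) hψ
  -- inner piece: the annulus hypothesis
  have hcos : qform su2Rep B (fun U => Real.cos (onePhase ℓ U) * ψ U) (fun U => Real.cos (onePhase ℓ U) * ψ U)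
      ≤ linkC B ^ 3 * Real.exp (-(E * lam) + C₁ * lam ^ 2) * nc := by
    refine hin B hB1' _ hcP fun U hU => ⟨fun z => hsupp U (right_ne_zero_of_mul hU) z, fun e => ?_⟩
    exact vacDist_lt_of_cos_onePhase_ne_zero hℓ0 (left_ne_zero_of_mul hU) e
  -- outer piece: crux ONE's OUTER at level `N`
  have hsin : qform su2Rep B (fun U => Real.sin (onePhase ℓ U) * ψ U) (fun U => Real.sin (onePhase ℓ U) * ψ U)
      ≤ linkC B ^ 3 * Real.exp (-(E * lam) + C₂ * lam ^ 2) * ns := by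
    refine (hout B hB2' ψ hψ).trans ?_
    rw [hCE]
    refine mul_le_mul_of_nonneg_right (mul_le_mul_of_nonneg_left (Real.exp_le_exp.mpr ?_) hlink) hns0
    have := mul_le_mul_of_nonneg_right hEN hlam0.le
    linarith
  -- common exponent `C'`
  have hrate : ∀ {Cx : ℝ}, Cx ≤ C' → Real.exp (-(E * lam) + Cx * lam ^ 2) ≤ Real.exp (-(E * lam) + C' * lam ^ 2) := by
    intro Cx hCx; exact Real.exp_le_exp.mpr (by nlinarith [sq_nonneg lam])
  have h1 : qform su2Rep B ψ ψ ≤ linkC B ^ 3 * Real.exp (-(E * lam) + C' * lam ^ 2) * Nn + linkC B ^ 3 * (D * lam ^ 2) * Nn := by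
    have hc' := mul_le_mul_of_nonneg_right (mul_le_mul_of_nonneg_left (hrate (le_max_left C₁ C₂)) hlink) hnc0
    have hs' := mul_le_mul_of_nonneg_right (mul_le_mul_of_nonneg_left (hrate (le_max_right C₁ C₂)) hlink) hns0
    have hd' : (1 / 2) * (9 * (Real.pi / 2 / ℓ) ^ 2 * (cM2 / B) * linkCE B) * Nn ≤ linkC B ^ 3 * (D * lam ^ 2) * Nn := by
      rw [hCE]
      refine mul_le_mul_of_nonneg_right ?_ hN0
      have := mul_le_mul_of_nonneg_right hdef hlink
      rw [hDdef]; nlinarith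
    have hsplit : linkC B ^ 3 * Real.exp (-(E * lam) + C' * lam ^ 2) * nc + linkC B ^ 3 * Real.exp (-(E * lam) + C' * lam ^ 2) * ns
        = linkC B ^ 3 * Real.exp (-(E * lam) + C' * lam ^ 2) * Nn := by rw [← hsum]; ring
    linarith [hims, hcos, hsin, hc', hs', hd', hsplit]
  have h2 := exp_add_defect_le (E := E) (C' := C') hD0 hlam0.le hlam1
  calc qform su2Rep B ψ ψ ≤ linkC B ^ 3 * (Real.exp (-(E * lam) + C' * lam ^ 2) + D * lam ^ 2) * Nn := by rw [mul_add, add_mul]; exact h1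
    _ ≤ linkC B ^ 3 * Real.exp (-(E * lam) + (C' + D * Real.exp (|E| + |C'|)) * lam ^ 2) * Nn :=
        mul_le_mul_of_nonneg_right (mul_le_mul_of_nonneg_left h2 hlink) hN0

end Summit.QuantumFields.YangMills.Theorems.FemtoTransferGap.RateTube

end
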